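import Mathlib
import Summits.Ventures.PercRepro.PuncturedLYMUnif44Table
import Summits.Ventures.PercRepro.PuncturedLYMUnif44Pos1

/-!
# PercRepro — (SP) FOR ANY NUMBER OF PAIRWISE DISJOINT `4`-SETS AT LEVEL `4`: POSITIVITY OF THE TABLE
(p10, gen 40)

The positivity of the denominators `Qp`, `Pp` and of `Yc`, `Pc` for `n ≥ 5`, `4k ≤ n`; `sel_nonneg` (by the class guards) and `raw_nonneg`.  Nothing here asserts (SP).
-/

namespace PercRepro.PuncturedLYM.Split.TypeLift.Unif44

/-- `Qp > 0` for `n ≥ 5`, `k ∈ {0} ∪ [1, ∞)`, `4k ≤ n`: `Qp` is linear in `k`, `Qp · n = (n − 4k) A + k (4A + nB)` with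
`A = Qp(n, 0)` and `4A + nB` positive for `n ≥ 5`. -/
theorem Qp_pos (n k : ℚ) (hn : 5 ≤ n) (hk1 : k = 0 ∨ 1 ≤ k) (hk : 4 * k ≤ n) : 0 < Qp n k := by
  obtain ⟨n', hn', rfl⟩ : ∃ n', 0 ≤ n' ∧ n = 5 + n' := ⟨n - 5, by linarith, by ring⟩
  have hA : 0 < 4 * n' ^ 2 + 31 * n' + 64 := by positivity
  have hC : 0 < 16 * n' ^ 2 + 124 * n' + 256 := by positivity
  have key : Qp (5 + n') k * (5 + n') = ((5 + n') - 4 * k) * (4 * n' ^ 2 + 31 * n' + 64) +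
      k * (16 * n' ^ 2 + 124 * n' + 256) := by
    unfold Qp; ring
  have hprod : 0 < Qp (5 + n') k * (5 + n') := by
    rw [key]
    have h1 : 0 ≤ ((5 + n') - 4 * k) * (4 * n' ^ 2 + 31 * n' + 64) := mul_nonneg (by linarith) hA.le
    rcases hk1 with rfl | hk1
    · nlinarith
    · have h2 : (16 * n' ^ 2 + 124 * n' + 256) ≤ k * (16 * n' ^ 2 + 124 * n' + 256) := le_mul_of_one_le_left hC.le hk1
      linarith
  have hn0 : (0 : ℚ) < 5 + n' := by linarith
  by_contra hneg
  have hle := not_lt.1 hneg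
  nlinarith [mul_nonneg (neg_nonneg.2 hle) hn0.le]

/-- `Pp > 0` for `n ≥ 5`, `4k ≤ n`. -/
theorem Pp_pos (n k : ℚ) (hn : 5 ≤ n) (hk : 4 * k ≤ n) : 0 < Pp n k := by
  obtain ⟨n', hn', rfl⟩ : ∃ n', 0 ≤ n' ∧ n = 5 + n' := ⟨n - 5, by linarith, by ring⟩
  have h : Pp (5 + n') k = (5 + n') * (n' ^ 3 + 9 * n' ^ 2 + 26 * n' + 18) - 24 * (k - (5 + n') / 4) := by
    unfold Pp; ring
  have h2 : 0 < (5 + n') * (n' ^ 3 + 9 * n' ^ 2 + 26 * n' + 18) := by positivity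
  rw [h]
  nlinarith

/-- `Yc > 0` for `n ≥ 5`. -/
theorem Yc_pos (n : ℚ) (hn : 5 ≤ n) : 0 < Yc n := by
  obtain ⟨n', hn', rfl⟩ : ∃ n', 0 ≤ n' ∧ n = 5 + n' := ⟨n - 5, by linarith, by ring⟩
  have h : Yc (5 + n') = (1 / 120) * n' ^ 5 + (1 / 8) * n' ^ 4 + (17 / 24) * n' ^ 3 + (15 / 8) * n' ^ 2 + (137 / 60) * n' + 1 := by unfold Yc; ring
  rw [h]; positivity

/-- `Pc = Pp / 24`. -/
theorem Pc_eq (n k : ℚ) : Pc n k = Pp n k / 24 := by unfold Pc Pp; ring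

/-- `Pc > 0` for `n ≥ 5`, `4k ≤ n`. -/
theorem Pc_pos (n k : ℚ) (hn : 5 ≤ n) (hk : 4 * k ≤ n) : 0 < Pc n k := by
  rw [Pc_eq]
  have h2 := Pp_pos n k hn hk
  positivity

/-- The class `(0, 0, 0)`: every direction's numerator is nonnegative on the class. -/
theorem sel_000_nonneg (n k : ℚ) (v : ℕ) (hn : 5 ≤ n) (hk1 : k = 0 ∨ 1 ≤ k) (hk : 0 ≤ k) (hf : 4 ≤ n - 4 * k) : 0 ≤ sel_000 v n k := by
  unfold sel_000
  split_ifs with h1 h2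
  · exact N_000_D0_nonneg n k (by rcases hk1 with h | h <;> linarith) hk1 hn hf
  · exact N_000_F_nonneg n k (by rcases hk1 with h | h <;> linarith) hk1 hn hf
  · exact le_refl 0

/-- The class `(1, 0, 0)`: every direction's numerator is nonnegative on the class. -/
theorem sel_100_nonneg (n k : ℚ) (v : ℕ) (hk : 1 ≤ k) (hf : 3 ≤ n - 4 * k) : 0 ≤ sel_100 v n k := by
  unfold sel_100
  split_ifs with h1 h2 h3
  · exact N_100_D0_nonneg n k hk hf
  · exact N_100_D1_nonneg n k hk hf
  · exact N_100_F_nonneg n k hk hf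
  · exact le_refl 0

/-- The class `(0, 1, 0)`: every direction's numerator is nonnegative on the class. -/
theorem sel_010_nonneg (n k : ℚ) (v : ℕ) (hk : 1 ≤ k) (hf : 2 ≤ n - 4 * k) : 0 ≤ sel_010 v n k := by
  unfold sel_010
  split_ifs with h1 h2 h3
  · exact N_010_D0_nonneg n k hk hf
  · exact N_010_D2_nonneg n k hk hf
  · exact N_010_F_nonneg n k hk hf
  · exact le_refl 0

/-- The class `(2, 0, 0)`: every direction's numerator is nonnegative on the class. -/
theorem sel_200_nonneg (n k : ℚ) (v : ℕ) (hk : 2 ≤ k) (hf : 2 ≤ n - 4 * k) : 0 ≤ sel_200 v n k := by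
  unfold sel_200
  split_ifs with h1 h2 h3
  · exact N_200_D0_nonneg n k hk hf
  · exact N_200_D1_nonneg n k hk hf
  · exact N_200_F_nonneg n k hk hf
  · exact le_refl 0

/-- The class `(0, 0, 1)`: every direction's numerator is nonnegative on the class. -/
theorem sel_001_nonneg (n k : ℚ) (v : ℕ) (hk : 1 ≤ k) (hf : 1 ≤ n - 4 * k) : 0 ≤ sel_001 v n k := by
  unfold sel_001
  split_ifs with h1 h2
  · exact N_001_D0_nonneg n k hk hf
  · exact N_001_F_nonneg n k hk hf
  · exact le_refl 0

/-- The class `(1, 1, 0)`: every direction's numerator is nonnegative on the class. -/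
theorem sel_110_nonneg (n k : ℚ) (v : ℕ) (hk : 2 ≤ k) (hf : 1 ≤ n - 4 * k) : 0 ≤ sel_110 v n k := by
  unfold sel_110
  split_ifs with h1 h2 h3 h4
  · exact N_110_D0_nonneg n k hk hf
  · exact N_110_D1_nonneg n k hk hf
  · exact N_110_D2_nonneg n k hk hf
  · exact N_110_F_nonneg n k hk hf
  · exact le_refl 0

/-- The class `(3, 0, 0)`: every direction's numerator is nonnegative on the class. -/
theorem sel_300_nonneg (n k : ℚ) (v : ℕ) (hk : 3 ≤ k) (hf : 1 ≤ n - 4 * k) : 0 ≤ sel_300 v n k := by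
  unfold sel_300
  split_ifs with h1 h2 h3
  · exact N_300_D0_nonneg n k hk hf
  · exact N_300_D1_nonneg n k hk hf
  · exact N_300_F_nonneg n k hk hf
  · exact le_refl 0

/-- The class `(0, 2, 0)`: every direction's numerator is nonnegative on the class. -/
theorem sel_020_nonneg (n k : ℚ) (v : ℕ) (hk : 2 ≤ k) (hf : 0 ≤ n - 4 * k) : 0 ≤ sel_020 v n k := by
  unfold sel_020
  split_ifs with h1 h2 h3
  · exact N_020_D0_nonneg n k hk hf
  · exact N_020_D2_nonneg n k hk hf
  · exact N_020_F_nonneg n k hk hf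
  · exact le_refl 0

/-- The class `(1, 0, 1)`: every direction's numerator is nonnegative on the class. -/
theorem sel_101_nonneg (n k : ℚ) (v : ℕ) (hk : 2 ≤ k) (hf : 0 ≤ n - 4 * k) : 0 ≤ sel_101 v n k := by
  unfold sel_101
  split_ifs with h1 h2 h3
  · exact N_101_D0_nonneg n k hk hf
  · exact N_101_D1_nonneg n k hk hf
  · exact N_101_F_nonneg n k hk hf
  · exact le_refl 0

/-- The class `(2, 1, 0)`: every direction's numerator is nonnegative on the class. -/
theorem sel_210_nonneg (n k : ℚ) (v : ℕ) (hk : 3 ≤ k) (hf : 0 ≤ n - 4 * k) : 0 ≤ sel_210 v n k := by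
  unfold sel_210
  split_ifs with h1 h2 h3 h4
  · exact N_210_D0_nonneg n k hk hf
  · exact N_210_D1_nonneg n k hk hf
  · exact N_210_D2_nonneg n k hk hf
  · exact N_210_F_nonneg n k hk hf
  · exact le_refl 0

/-- The class `(4, 0, 0)`: every direction's numerator is nonnegative on the class. -/
theorem sel_400_nonneg (n k : ℚ) (v : ℕ) (hk : 4 ≤ k) (hf : 0 ≤ n - 4 * k) : 0 ≤ sel_400 v n k := by
  unfold sel_400
  split_ifs with h1 h2 h3
  · exact N_400_D0_nonneg n k hk hf
  · exact N_400_D1_nonneg n k hk hf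
  · exact N_400_F_nonneg n k hk hf
  · exact le_refl 0

/-- Every numerator of the table is nonnegative on its class. -/
theorem sel_nonneg (n k : ℚ) (c1 c2 c3 v : ℕ) (hn : 5 ≤ n) (hk1 : k = 0 ∨ 1 ≤ k) (hk : (c1 : ℚ) + c2 + c3 ≤ k)
    (hf : (4 : ℚ) - c1 - 2 * c2 - 3 * c3 ≤ n - 4 * k) : 0 ≤ sel c1 c2 c3 v n k := by
  unfold sel
  by_cases g1 : c1 = 0 ∧ c2 = 0 ∧ c3 = 0
  · rw [if_pos g1]
    obtain ⟨rfl, rfl, rfl⟩ := g1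
    exact sel_000_nonneg n k v hn hk1 (by push_cast at hk; linarith) (by push_cast at hf; linarith)
  rw [if_neg g1]
  by_cases g2 : c1 = 1 ∧ c2 = 0 ∧ c3 = 0
  · rw [if_pos g2]
    obtain ⟨rfl, rfl, rfl⟩ := g2
    exact sel_100_nonneg n k v (by push_cast at hk; linarith) (by push_cast at hf; linarith)
  rw [if_neg g2]
  by_cases g3 : c1 = 0 ∧ c2 = 1 ∧ c3 = 0
  · rw [if_pos g3]
    obtain ⟨rfl, rfl, rfl⟩ := g3
    exact sel_010_nonneg n k v (by push_cast at hk; linarith) (by push_cast at hf; linarith)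
  rw [if_neg g3]
  by_cases g4 : c1 = 2 ∧ c2 = 0 ∧ c3 = 0
  · rw [if_pos g4]
    obtain ⟨rfl, rfl, rfl⟩ := g4
    exact sel_200_nonneg n k v (by push_cast at hk; linarith) (by push_cast at hf; linarith)
  rw [if_neg g4]
  by_cases g5 : c1 = 0 ∧ c2 = 0 ∧ c3 = 1
  · rw [if_pos g5]
    obtain ⟨rfl, rfl, rfl⟩ := g5
    exact sel_001_nonneg n k v (by push_cast at hk; linarith) (by push_cast at hf; linarith)
  rw [if_neg g5]
  by_cases g6 : c1 = 1 ∧ c2 = 1 ∧ c3 = 0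
  · rw [if_pos g6]
    obtain ⟨rfl, rfl, rfl⟩ := g6
    exact sel_110_nonneg n k v (by push_cast at hk; linarith) (by push_cast at hf; linarith)
  rw [if_neg g6]
  by_cases g7 : c1 = 3 ∧ c2 = 0 ∧ c3 = 0
  · rw [if_pos g7]
    obtain ⟨rfl, rfl, rfl⟩ := g7
    exact sel_300_nonneg n k v (by push_cast at hk; linarith) (by push_cast at hf; linarith)
  rw [if_neg g7]
  by_cases g8 : c1 = 0 ∧ c2 = 2 ∧ c3 = 0
  · rw [if_pos g8]
    obtain ⟨rfl, rfl, rfl⟩ := g8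
    exact sel_020_nonneg n k v (by push_cast at hk; linarith) (by push_cast at hf; linarith)
  rw [if_neg g8]
  by_cases g9 : c1 = 1 ∧ c2 = 0 ∧ c3 = 1
  · rw [if_pos g9]
    obtain ⟨rfl, rfl, rfl⟩ := g9
    exact sel_101_nonneg n k v (by push_cast at hk; linarith) (by push_cast at hf; linarith)
  rw [if_neg g9]
  by_cases g10 : c1 = 2 ∧ c2 = 1 ∧ c3 = 0
  · rw [if_pos g10]
    obtain ⟨rfl, rfl, rfl⟩ := g10
    exact sel_210_nonneg n k v (by push_cast at hk; linarith) (by push_cast at hf; linarith)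
  rw [if_neg g10]
  by_cases g11 : c1 = 4 ∧ c2 = 0 ∧ c3 = 0
  · rw [if_pos g11]
    obtain ⟨rfl, rfl, rfl⟩ := g11
    exact sel_400_nonneg n k v (by push_cast at hk; linarith) (by push_cast at hf; linarith)
  rw [if_neg g11]

/-- The unnormalised weights are nonnegative on their classes. -/
theorem raw_nonneg (n k : ℚ) (c1 c2 c3 v : ℕ) (hn : 5 ≤ n) (hk3 : 4 * k ≤ n) (hk1 : k = 0 ∨ 1 ≤ k)
    (hk : (c1 : ℚ) + c2 + c3 ≤ k) (hf : (4 : ℚ) - c1 - 2 * c2 - 3 * c3 ≤ n - 4 * k) : 0 ≤ raw n k c1 c2 c3 v := by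
  unfold raw
  have hQ := Qp_pos n k hn hk1 hk3
  have hP := Pp_pos n k hn hk3
  exact div_nonneg (sel_nonneg n k c1 c2 c3 v hn hk1 hk hf) (by positivity)

end PercRepro.PuncturedLYM.Split.TypeLift.Unif44
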